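import Summits.Schanuel.Schanuel.Theorems.DiophantineDichotomyKhovanskiiApproxTypeEvPairSumResultant
import Summits.Schanuel.Schanuel.Theorems.DiophantineDichotomyKhovanskiiApproxTypeEvPairSumBasic
import Summits.Schanuel.Schanuel.Theorems.DiophantineDichotomyKhovanskiiApproxTypeEvPairSumCoeffBound

/-!
# The sum of two challenger coordinates satisfies the admissibility clause (`stub_clauseAdd`)

Line `Sketch` of crux `DiophantineDichotomy.KhovanskiiApproxTypeEv` (stmt-Schanuel-14972), registered stub
`stub_clauseAdd` of skeleton v8 — the glue of the three landed pair-sum stubs: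
if `α`, `β ∈ ℂ` are roots of non-zero integer polynomials of degrees `≤ p`, `≤ q` and naive heights `≤ A`,
`≤ B`, then `α + β` is a root of a non-zero integer polynomial of degree `≤ pq` and naive height
`≤ 4^{pq} ((q+1)B)^p ((p+1)A)^q` — log-height `≍ p log B + q log A + O(pq)`, the Mahler-measure quality
(a house bound would give `pq · log`, useless for the certificate).  The annihilator is the resultant
`R = Res_Y(P(Y), Q(X − Y)) ∈ ℤ[X]` (`stub_pairSumResultant`, p143374), whose image in `ℂ[X]` is
`S = lc(P_ℂ)^{deg Q} ∏_{P(a)=0} Q_ℂ(X − a)`; `S ≠ 0`, `deg S = deg P · deg Q`, `S(α+β) = 0`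
(`stub_pairSumBasic`, p143503) and `|coeff S| ≤ 4^{pq}((q+1)B)^p((p+1)A)^q` (`stub_pairSumCoeffBound`,
p143542).  Everything here is proved; no named facts.
-/

noncomputable section

set_option linter.dupNamespace false -- mandated summit/sub-problem namespace (single-conjunct summit)

namespace Summit.Schanuel.Schanuel.Cruxes.KhovanskiiApproxTypeEv.AnchoredReduction

open Polynomial

/-- A coefficient bound `|coeff| ≤ A` on a non-zero integer polynomial forces `1 ≤ A`. [folklore] -/
theorem one_le_of_coeff_abs_le {P : ℤ[X]} (hP : P ≠ 0) {A : ℕ} (hA : ∀ k, |P.coeff k| ≤ (A : ℤ)) :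
    1 ≤ A := by
  have h : (1 : ℤ) ≤ A := (Int.one_le_abs (leadingCoeff_ne_zero.2 hP)).trans (hA P.natDegree)
  exact_mod_cast h

/-- Monotonicity of the height bound `4^{pq} ((q+1)B)^p ((p+1)A)^q` in the degrees `p, q`
(for `A, B ≥ 1`), over `ℝ`. [folklore] -/
theorem pairSum_bound_mono {p p' q q' A B : ℕ} (hp : p' ≤ p) (hq : q' ≤ q) (hA : 1 ≤ A) (hB : 1 ≤ B) :
    (4 : ℝ) ^ (p' * q') * (((q' : ℝ) + 1) * B) ^ p' * (((p' : ℝ) + 1) * A) ^ q' ≤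
      (4 : ℝ) ^ (p * q) * (((q : ℝ) + 1) * B) ^ p * (((p : ℝ) + 1) * A) ^ q := by
  have hA1 : (1 : ℝ) ≤ A := by exact_mod_cast hA
  have hB1 : (1 : ℝ) ≤ B := by exact_mod_cast hB
  have hp' : (p' : ℝ) ≤ p := by exact_mod_cast hp
  have hq' : (q' : ℝ) ≤ q := by exact_mod_cast hq
  have hbaseB : (1 : ℝ) ≤ ((q : ℝ) + 1) * B := by nlinarith [(Nat.cast_nonneg q : (0 : ℝ) ≤ q)]
  have hbaseA : (1 : ℝ) ≤ ((p : ℝ) + 1) * A := by nlinarith [(Nat.cast_nonneg p : (0 : ℝ) ≤ p)]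
  have h4 : (4 : ℝ) ^ (p' * q') ≤ (4 : ℝ) ^ (p * q) :=
    pow_le_pow_right₀ (by norm_num) (Nat.mul_le_mul hp hq)
  have hBpow : (((q' : ℝ) + 1) * B) ^ p' ≤ (((q : ℝ) + 1) * B) ^ p :=
    calc (((q' : ℝ) + 1) * B) ^ p' ≤ (((q : ℝ) + 1) * B) ^ p' :=
          pow_le_pow_left₀ (by positivity) (by nlinarith [(Nat.cast_nonneg B : (0 : ℝ) ≤ B)]) _
      _ ≤ (((q : ℝ) + 1) * B) ^ p := pow_le_pow_right₀ hbaseB hp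
  have hApow : (((p' : ℝ) + 1) * A) ^ q' ≤ (((p : ℝ) + 1) * A) ^ q :=
    calc (((p' : ℝ) + 1) * A) ^ q' ≤ (((p : ℝ) + 1) * A) ^ q' :=
          pow_le_pow_left₀ (by positivity) (by nlinarith [(Nat.cast_nonneg A : (0 : ℝ) ≤ A)]) _
      _ ≤ (((p : ℝ) + 1) * A) ^ q := pow_le_pow_right₀ hbaseA hq
  exact mul_le_mul (mul_le_mul h4 hBpow (by positivity) (by positivity)) hApow (by positivity)
    (by positivity)

/-- **`stub_clauseAdd` — THE SUM OF TWO CHALLENGER COORDINATES** (registered stub of line `Sketch`,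
skeleton v8): if `α`, `β` are roots of non-zero integer polynomials of degrees `≤ p`, `≤ q` and naive
heights `≤ A`, `≤ B`, then `α + β` is a root of a non-zero integer polynomial of degree `≤ pq` and naive
height `≤ 4^{pq} ((q+1)B)^p ((p+1)A)^q`.  The witness is the resultant `Res_Y(P(Y), Q(X − Y))`. [folklore] -/
theorem stub_clauseAdd {α β : ℂ} {p q A B : ℕ}
    (hα : ∃ P : Polynomial ℤ, P ≠ 0 ∧ P.natDegree ≤ p ∧ (∀ k, |P.coeff k| ≤ (A : ℤ)) ∧
      Polynomial.aeval α P = 0)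
    (hβ : ∃ Q : Polynomial ℤ, Q ≠ 0 ∧ Q.natDegree ≤ q ∧ (∀ k, |Q.coeff k| ≤ (B : ℤ)) ∧
      Polynomial.aeval β Q = 0) :
    ∃ R : Polynomial ℤ, R ≠ 0 ∧ R.natDegree ≤ p * q ∧
      (∀ k, |R.coeff k| ≤ ((4 ^ (p * q) * ((q + 1) * B) ^ p * ((p + 1) * A) ^ q : ℕ) : ℤ)) ∧
      Polynomial.aeval (α + β) R = 0 := by
  obtain ⟨P, hP0, hPdeg, hPA, hPα⟩ := hα
  obtain ⟨Q, hQ0, hQdeg, hQB, hQβ⟩ := hβ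
  obtain ⟨R, hR⟩ := stub_pairSumResultant P Q hP0 hQ0
  obtain ⟨hS0, hSdeg, hSroot⟩ := stub_pairSumBasic P Q hP0 hQ0 α β hPα hQβ
  have hScoeff := stub_pairSumCoeffBound P Q hP0 hQ0 A B hPA hQB
  have hinj : Function.Injective (Int.castRingHom ℂ) := (Int.castRingHom ℂ).injective_int
  have hA1 : 1 ≤ A := one_le_of_coeff_abs_le hP0 hPA
  have hB1 : 1 ≤ B := one_le_of_coeff_abs_le hQ0 hQB
  refine ⟨R, ?_, ?_, ?_, ?_⟩
  · intro h
    apply hS0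
    rw [← hR, h, Polynomial.map_zero]
  · rw [← natDegree_map_eq_of_injective hinj R, hR, hSdeg]
    exact Nat.mul_le_mul hPdeg hQdeg
  · intro k
    have h1 : ‖(R.map (Int.castRingHom ℂ)).coeff k‖ = ((|R.coeff k| : ℤ) : ℝ) := by
      rw [coeff_map, eq_intCast, Complex.norm_intCast, Int.cast_abs]
    have h2 : ‖(R.map (Int.castRingHom ℂ)).coeff k‖ ≤ (4 : ℝ) ^ (P.natDegree * Q.natDegree) *
        (((Q.natDegree : ℝ) + 1) * B) ^ P.natDegree * (((P.natDegree : ℝ) + 1) * A) ^ Q.natDegree := by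
      rw [hR]
      exact hScoeff k
    have h3 := pairSum_bound_mono (A := A) (B := B) hPdeg hQdeg hA1 hB1
    have h4 : ((|R.coeff k| : ℤ) : ℝ) ≤
        ((4 ^ (p * q) * ((q + 1) * B) ^ p * ((p + 1) * A) ^ q : ℕ) : ℝ) := by
      rw [← h1]
      push_cast
      exact h2.trans h3
    exact_mod_cast h4
  · rw [aeval_def, ← eval_map, algebraMap_int_eq, hR]
    exact hSroot

end Summit.Schanuel.Schanuel.Cruxes.KhovanskiiApproxTypeEv.AnchoredReduction

end
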